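import Literature.Computability.QuantumComplexity.OneCleanQubitPolarization
import Literature.Computability.QuantumComplexity.PolyCopies
import HarnessLib

/-!
# `DQC1 ⊆ BQP`, I: purification of the one-clean-qubit register

Topic `Literature/Computability/QuantumComplexity`; first file of the discharge of the named fact
`knillLaflamme1998_DQC1_subset_BQP` (`OneCleanQubit.lean`; Knill–Laflamme 1998, p. 5675: DQC1 has
"power between classical computation and deterministic quantum computation with pure states";
Shor–Jordan 2008, §1). The folklore containment has three ingredients: (i) the maximally mixed
register of the one-clean-qubit model is one half of a maximally entangled pure state
(Nielsen–Chuang 2010, §2.5: purification; Shor–Jordan 2008, §1 p. 3: "choosing `|ψ⟩` uniformly at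
random from the `2ⁿ` computational basis states is exactly the same as inputting the density
matrix `I/2ⁿ`"), (ii) the `1/poly` bias is amplified by a polynomial number of independent runs
and a majority vote (Bennett–Bernstein–Brassard–Vazirani 1997, Thm. 4.13), (iii) per-input
polynomial-time generated circuits are decided by a uniform family (here: through the tree's
`PromiseBQP`-complete circuit problem, `Lemma24SignHard.lean`).

This file is (i), at the level of one block. For an oracle-free Clifford+`T` circuit `C` on
`1 + k` wires (clean wire `0`, register `1 … k`) the **purified circuit** `purify C` on
`1 + k + k` wires first puts a Hadamard gate on each *copy* wire `1 + k + i`, then copies it onto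
the register wire `1 + i` by a `CNOT` (register and copies now form `k` Bell pairs,
`(1/√2^k) ∑_s |0, s⟩|s⟩`), then runs `C` on the first `1 + k` wires. Main results:

* `purify_mulVec_zero_apply` — the output state on `|0…0⟩`, entrywise:
  `(1/√2)^k · ⟨x|_{sys}| C |0, x|_{copy}⟩`;
* `sum_accept_purify` — **the probability that wire `0` reads `1` is the one-clean-qubit
  acceptance probability** `oneCleanQubitAcceptProb C` (the uniform average over the basis inputs
  of the register, `OneCleanQubitPolarization.lean`);
* `sum_normSq_purify` (unit norm), `purify_isOracleFree`, and the description
  `flatMap_gateEnc_purify : bits = hBits k ++ cnot bits ++ C.encode` (the code of `C` verbatim).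

## References

* E. Knill, R. Laflamme, Phys. Rev. Lett. 81 (1998) 5672–5675, p. 5673 (DQC1), p. 5675 [KnillLaflamme1998].
* P. W. Shor, S. P. Jordan, Quantum Inf. Comput. 8 (2008) 681–714, §1 (pp. 2–3 of arXiv:0707.2831) [ShorJordan2008].
* M. A. Nielsen, I. L. Chuang, *Quantum Computation and Quantum Information*, CUP 2010, §1.3.6
  (Bell states from `H` and `CNOT`), §2.5 (purification), §2.2.8 [NielsenChuang2010].
-/

noncomputable section

namespace Literature.Computability.QuantumComplexity

namespace DQC1Amp

open _root_.Computability Complexity Cryptography RevSim RevDesc Function Matrix Finset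

variable {k : ℕ}

/-! ### Wires of the purified block -/

/-- The purified block has a wire. [folklore] -/
theorem pw_pos (k : ℕ) : 0 < 1 + k + k := by omega

/-- The system wires `0, …, k` (clean wire and register) inside the purified block. [folklore] -/
def sysEmb (k : ℕ) : Fin (1 + k) ↪ Fin (1 + k + k) := Fin.castLEEmb (Nat.le_add_right (1 + k) k)

/-- Copy wire `i`: wire `1 + k + i`. [cite: NielsenChuang2010, §2.5] -/
def copyW (i : Fin k) : Fin (1 + k + k) := Fin.natAdd (1 + k) i

/-- Register wire `i`: wire `1 + i`. [cite: ShorJordan2008, §1 p. 2] -/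
def regW (i : Fin k) : Fin (1 + k + k) := sysEmb k (Fin.natAdd 1 i)

/-- The clean wire `0`. [cite: KnillLaflamme1998, p. 5673] -/
def cleanW (k : ℕ) : Fin (1 + k + k) := ⟨0, pw_pos k⟩

/-- Value of a system wire. [folklore] -/
@[simp] theorem val_sysEmb (j : Fin (1 + k)) : (sysEmb k j : ℕ) = j := rfl

/-- Value of a copy wire. [folklore] -/
@[simp] theorem val_copyW (i : Fin k) : (copyW i : ℕ) = 1 + k + i := rfl

/-- Value of a register wire. [folklore] -/
@[simp] theorem val_regW (i : Fin k) : (regW i : ℕ) = 1 + i := rfl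

/-- `copyW` is injective. [folklore] -/
theorem copyW_injective : Injective (copyW (k := k)) := fun i j h => by
  have := congrArg Fin.val h; simp at this; exact Fin.ext this

/-- Copy wires are not system wires. [folklore] -/
theorem copyW_not_mem_range (i : Fin k) : copyW i ∉ Set.range (sysEmb k) := by
  rintro ⟨j, hj⟩
  have := congrArg Fin.val hj
  simp at this
  have := j.isLt
  omega

/-- Off the system wires means a copy wire. [folklore] -/
theorem not_mem_range_sysEmb_iff (w : Fin (1 + k + k)) : w ∉ Set.range (sysEmb k) ↔ 1 + k ≤ (w : ℕ) :=
  not_mem_range_castLEEmb_iff _ w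

/-- The copy wires, in order. [folklore] -/
def copyWires (k : ℕ) : List (Fin (1 + k + k)) := (List.finRange k).map copyW

/-- The copy wires are pairwise distinct. [folklore] -/
theorem nodup_copyWires (k : ℕ) : (copyWires k).Nodup :=
  (List.nodup_finRange k).map copyW_injective

/-- Membership in the copy wires. [folklore] -/
theorem mem_copyWires_iff (w : Fin (1 + k + k)) : w ∈ copyWires k ↔ 1 + k ≤ (w : ℕ) := by
  constructor
  · intro h
    obtain ⟨i, -, rfl⟩ := List.mem_map.1 h
    simp
  · intro h
    refine List.mem_map.2 ⟨⟨w - (1 + k), by have := w.isLt; omega⟩, List.mem_finRange _, Fin.ext ?_⟩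
    simp; omega

/-! ### The gates -/

/-- The Hadamard layer on the copy wires. [cite: NielsenChuang2010, §1.3.6] -/
def hLayer (k : ℕ) : List (QGate cliffordT (1 + k + k)) := (copyWires k).map hOn

/-- The copying `CNOT`s, copy wire `1 + k + i` onto register wire `1 + i`, as a classical
reversible program over `ℕ`-indexed wires. [cite: NielsenChuang2010, §1.3.6] -/
def cnotProg (k : ℕ) : List (ClOp ℕ) := (List.range k).map fun i => ClOp.cnot (1 + k + i) (1 + i)

/-- Membership in `cnotProg`. [folklore] -/
theorem mem_cnotProg {op : ClOp ℕ} : op ∈ cnotProg k ↔ ∃ i < k, op = ClOp.cnot (1 + k + i) (1 + i) := by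
  simp only [cnotProg, List.mem_map, List.mem_range]
  constructor
  · rintro ⟨i, hi, rfl⟩; exact ⟨i, hi, rfl⟩
  · rintro ⟨i, hi, rfl⟩; exact ⟨i, hi, rfl⟩

/-- `cnotProg` is well formed. [folklore] -/
theorem cnotProg_wf (k : ℕ) : ∀ op ∈ cnotProg k, op.WF := by
  intro op hop
  obtain ⟨i, hi, rfl⟩ := mem_cnotProg.1 hop
  change 1 + k + i ≠ 1 + i
  omega

/-- `cnotProg` uses wires of the block. [folklore] -/
theorem cnotProg_lt (k : ℕ) : ∀ op ∈ cnotProg k, ∀ p ∈ wiresOf op, p < 1 + k + k := by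
  intro op hop p hp
  obtain ⟨i, hi, rfl⟩ := mem_cnotProg.1 hop
  simp only [mem_wiresOf, ClOp.target, ClOp.controls, List.mem_singleton] at hp
  rcases hp with rfl | rfl <;> omega

/-- The copying `CNOT` layer, compiled. [cite: NielsenChuang2010, §1.3.6] -/
def cnotLayer (k : ℕ) : List (QGate cliffordT (1 + k + k)) :=
  revCompile (toRevList ((cnotProg k).map (ClOp.map (finOf (1 + k + k) (pw_pos k)))) fun op hop => by
    simp only [List.mem_map] at hop
    obtain ⟨op, hop, rfl⟩ := hop
    exact wf_map_finOf _ (cnotProg_lt k op hop) (cnotProg_wf k op hop))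

/-- **The purified circuit** of `C` (on `1 + k` wires): Hadamards on the copies, copying
`CNOT`s, then `C` on the system wires `0, …, k`. [cite: NielsenChuang2010, §2.5] [cite: ShorJordan2008, §1 p. 3] -/
def purify (C : QCircuit cliffordT (1 + k)) : QCircuit cliffordT (1 + k + k) :=
  ⟨hLayer k ++ (cnotLayer k ++ (mapWires (sysEmb k) C).gates)⟩

/-- The purified circuit is oracle-free (if `C` is). [folklore] -/
theorem purify_isOracleFree {C : QCircuit cliffordT (1 + k)} (hC : C.IsOracleFree) : (purify C).IsOracleFree := by
  intro g hg
  rcases List.mem_append.1 hg with h | h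
  · obtain ⟨w, -, rfl⟩ := List.mem_map.1 h
    exact hOn_isOracleFree w
  rcases List.mem_append.1 h with h | h
  · exact revCompile_isOracleFree _ g h
  · exact isOracleFree_mapWires _ hC g h

/-! ### The copying layer permutes basis states -/

/-- The basis permutation of the copying layer: register wire `1 + i` becomes
`z (1 + i) ⊕ z (1 + k + i)`. [cite: NielsenChuang2010, §1.3.6] -/
def cflip (z : QReg (1 + k + k)) : QReg (1 + k + k) := fun w => clEval (cnotProg k) (liftW z) w

/-- Targets of `cnotProg` are never controls. [folklore] -/
theorem cnotProg_disjoint (k : ℕ) : ∀ op ∈ cnotProg k, ∀ op' ∈ cnotProg k, op'.target ∉ op.controls := by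
  intro op hop op' hop'
  obtain ⟨i, hi, rfl⟩ := mem_cnotProg.1 hop
  obtain ⟨i', hi', rfl⟩ := mem_cnotProg.1 hop'
  simp only [ClOp.target, ClOp.controls, List.mem_singleton]
  omega

/-- The targets of `cnotProg` are pairwise distinct. [folklore] -/
theorem nodup_targets_cnotProg (k : ℕ) : ((cnotProg k).map ClOp.target).Nodup := by
  rw [cnotProg, List.map_map]
  exact List.nodup_range.map_on fun a _ b _ h => by simp only [Function.comp_apply, ClOp.target] at h; omega

/-- **The copying layer on a register wire.** [cite: NielsenChuang2010, §1.3.6] -/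
theorem cflip_regW (z : QReg (1 + k + k)) (i : Fin k) : cflip z (regW i) = (z (regW i) ^^ z (copyW i)) := by
  have hmem : ClOp.cnot (1 + k + (i : ℕ)) (1 + i) ∈ cnotProg k := mem_cnotProg.2 ⟨i, i.isLt, rfl⟩
  have h := clEval_apply_target_of_nodup (cnotProg k) (cnotProg_disjoint k) (nodup_targets_cnotProg k) (liftW z) hmem
  simp only [ClOp.target, ClOp.guard] at h
  unfold cflip
  rw [show ((regW i : Fin (1 + k + k)) : ℕ) = 1 + i from rfl, h, ← val_regW i, liftW_val, ← val_copyW i, liftW_val]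

/-- **The copying layer off the register wires** is the identity. [folklore] -/
theorem cflip_of_not (z : QReg (1 + k + k)) (w : Fin (1 + k + k)) (hw : ¬ (1 ≤ (w : ℕ) ∧ (w : ℕ) < 1 + k)) :
    cflip z w = z w := by
  unfold cflip
  rw [clEval_apply_of_forall_target_ne _ _ (fun op hop e => ?_), liftW_val]
  obtain ⟨i, hi, rfl⟩ := mem_cnotProg.1 hop
  simp only [ClOp.target] at e
  omega

/-- The copying layer on the clean wire is the identity. [folklore] -/
theorem cflip_cleanW (z : QReg (1 + k + k)) : cflip z (cleanW k) = z (cleanW k) :=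
  cflip_of_not z _ (by simp [cleanW])

/-- The copying layer on a copy wire is the identity. [folklore] -/
theorem cflip_copyW (z : QReg (1 + k + k)) (i : Fin k) : cflip z (copyW i) = z (copyW i) :=
  cflip_of_not z _ (by simp)

/-- **The copying layer is an involution.** [folklore] -/
theorem cflip_cflip (z : QReg (1 + k + k)) : cflip (cflip z) = z := by
  funext w
  by_cases hw : 1 ≤ (w : ℕ) ∧ (w : ℕ) < 1 + k
  · have e : w = regW ⟨w - 1, by omega⟩ := Fin.ext (by simp; omega)
    rw [e, cflip_regW, cflip_regW, cflip_copyW, Bool.xor_assoc, Bool.xor_self, Bool.xor_false]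
  · rw [cflip_of_not _ _ hw, cflip_of_not _ _ hw]

/-- `cflip` as an injective self-map of the basis labels. [folklore] -/
def cflipEmb (k : ℕ) : QReg (1 + k + k) ↪ QReg (1 + k + k) :=
  ⟨cflip, fun z z' h => by rw [← cflip_cflip z, h, cflip_cflip]⟩

/-- `cflipEmb` applied. [folklore] -/
@[simp] theorem cflipEmb_apply (z : QReg (1 + k + k)) : cflipEmb k z = cflip z := rfl

/-- The inverse of `cflipEmb` is itself. [folklore] -/
theorem cflipEmb_symm_apply (y : QReg (1 + k + k)) : (cflipEmb k).equivOfFiniteSelfEmbedding.symm y = cflip y := by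
  apply (cflipEmb k).equivOfFiniteSelfEmbedding.injective
  rw [Equiv.apply_symm_apply]
  change y = cflip (cflip y)
  rw [cflip_cflip]

/-- **The compiled copying layer permutes the basis states along `cflip`.** [cite: NielsenChuang2010, §1.3.6] -/
theorem cnotLayer_mulVec_basisState (z : QReg (1 + k + k)) :
    (⟨cnotLayer k⟩ : QCircuit cliffordT (1 + k + k)).toMatrix 0 *ᵥ basisState z = basisState (cflip z) := by
  unfold cnotLayer
  rw [revCompile_mulVec_basisState, revEval_toRevList]
  congr 1
  funext w
  rw [clEval_map_finOf_apply _ _ (cnotProg_lt k)]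
  rfl

/-! ### The output state of the purified circuit on `|0…0⟩` -/

/-- The content of the copy wires. [folklore] -/
def copyOf (x : QReg (1 + k + k)) : QReg k := fun i => x (copyW i)

/-- The one-clean-qubit input `|0⟩|r⟩`. [cite: ShorJordan2008, §1 p. 2] -/
def inp (r : QReg k) : QReg (1 + k) := Fin.append (fun _ : Fin 1 => false) r

/-- **The Hadamard layer on `|0…0⟩`**: amplitude `(1/√2)^k` on the labels vanishing off the copy
wires. [cite: NielsenChuang2010, §1.4.4] -/
theorem hLayer_mulVec_zero :
    (⟨hLayer k⟩ : QCircuit cliffordT (1 + k + k)).toMatrix 0 *ᵥ basisState (fun _ => false) =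
      fun z => if (∀ j : Fin (1 + k + k), (j : ℕ) < 1 + k → z j = false) then invSqrt2 ^ k else 0 := by
  unfold hLayer
  rw [hadamards_mulVec_basisState (copyWires k) (nodup_copyWires k) _ (fun _ _ => rfl)]
  funext z
  have hlen : (copyWires k).length = k := by simp [copyWires]
  have hc : (∀ j, j ∉ copyWires k → z j = false) ↔ ∀ j : Fin (1 + k + k), (j : ℕ) < 1 + k → z j = false := by
    simp only [mem_copyWires_iff, not_le]
  rw [hlen]
  by_cases h : ∀ j : Fin (1 + k + k), (j : ℕ) < 1 + k → z j = false
  · rw [if_pos h, if_pos (hc.2 h)]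
  · rw [if_neg h, if_neg (fun h' => h (hc.1 h'))]

/-- After the copying layer: amplitude `(1/√2)^k` on the *balanced* labels (clean wire `0`,
register = copies). [cite: NielsenChuang2010, §1.3.6 (Bell states)] -/
theorem cnotLayer_hLayer_mulVec_zero_apply (y : QReg (1 + k + k)) :
    ((⟨cnotLayer k⟩ : QCircuit cliffordT (1 + k + k)).toMatrix 0 *ᵥ
        ((⟨hLayer k⟩ : QCircuit cliffordT (1 + k + k)).toMatrix 0 *ᵥ basisState (fun _ => false))) y =
      if (∀ j : Fin (1 + k + k), (j : ℕ) < 1 + k → cflip y j = false) then invSqrt2 ^ k else 0 := by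
  rw [mulVec_eq_of_perm (cflipEmb k) (fun z => cnotLayer_mulVec_basisState z)]
  dsimp only
  rw [cflipEmb_symm_apply, hLayer_mulVec_zero]

/-- System wire `j` of the label `x` with the system wires overwritten by `u` is `u j`. [folklore] -/
theorem extend_sysEmb_apply (u : QReg (1 + k)) (x : QReg (1 + k + k)) (j : Fin (1 + k)) :
    Function.extend (sysEmb k) u x (sysEmb k j) = u j :=
  (sysEmb k).injective.extend_apply _ _ j

/-- Copy wire `i` of the label `x` with the system wires overwritten is `x (copyW i)`. [folklore] -/
theorem extend_sysEmb_copyW (u : QReg (1 + k)) (x : QReg (1 + k + k)) (i : Fin k) :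
    Function.extend (sysEmb k) u x (copyW i) = x (copyW i) :=
  extend_apply_of_not_mem _ _ _ (copyW_not_mem_range i)

/-- A label of `1 + k` wires is `|0⟩|r⟩` iff its clean bit is `0` and its register is `r`. [folklore] -/
theorem eq_inp_iff (u : QReg (1 + k)) (r : QReg k) :
    u = inp r ↔ u ⟨0, Nat.add_pos_left Nat.one_pos k⟩ = false ∧ ∀ i, u (Fin.natAdd 1 i) = r i := by
  constructor
  · rintro rfl
    exact ⟨append_apply_zero false r _, fun i => Fin.append_right _ _ i⟩
  · rintro ⟨h0, h1⟩
    funext j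
    refine Fin.addCases (fun j₁ => ?_) (fun i => ?_) j
    · have e : Fin.castAdd k j₁ = ⟨0, Nat.add_pos_left Nat.one_pos k⟩ :=
        Fin.ext (by change (j₁ : ℕ) = 0; have := j₁.isLt; omega)
      rw [e, h0, inp, append_apply_zero]
    · rw [h1 i, inp, Fin.append_right]

/-- **The balance condition on an overwritten label** singles out the input `|0⟩|copies of x⟩`.
[cite: NielsenChuang2010, §1.3.6] -/
theorem balanced_extend_iff (u : QReg (1 + k)) (x : QReg (1 + k + k)) :
    (∀ j : Fin (1 + k + k), (j : ℕ) < 1 + k → cflip (Function.extend (sysEmb k) u x) j = false) ↔ u = inp (copyOf x) := by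
  rw [eq_inp_iff]
  constructor
  · intro h
    refine ⟨?_, fun i => ?_⟩
    · have h0 := h (cleanW k) (by simp [cleanW])
      rw [cflip_cleanW, show cleanW k = sysEmb k ⟨0, Nat.add_pos_left Nat.one_pos k⟩ from Fin.ext rfl,
        extend_sysEmb_apply] at h0
      exact h0
    · have h1 := h (regW i) (by simp)
      rw [cflip_regW, regW, extend_sysEmb_apply, extend_sysEmb_copyW] at h1
      change u (Fin.natAdd 1 i) = x (copyW i)
      revert h1
      cases u (Fin.natAdd 1 i) <;> cases x (copyW i) <;> simp
  · rintro ⟨h0, h1⟩ j hj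
    by_cases hj1 : 1 ≤ (j : ℕ)
    · have e : j = regW ⟨j - 1, by omega⟩ := Fin.ext (by simp; omega)
      rw [e, cflip_regW, regW, extend_sysEmb_apply, extend_sysEmb_copyW, h1]
      simp [copyOf]
    · have e : j = sysEmb k ⟨0, Nat.add_pos_left Nat.one_pos k⟩ := Fin.ext (by change (j : ℕ) = 0; omega)
      rw [cflip_of_not _ _ (fun h => hj1 h.1), e, extend_sysEmb_apply, h0]

/-- The purified circuit as a composite. [folklore] -/
theorem purify_eq_append (C : QCircuit cliffordT (1 + k)) :
    purify C = (⟨hLayer k⟩ : QCircuit cliffordT (1 + k + k)).append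
      ((⟨cnotLayer k⟩ : QCircuit cliffordT (1 + k + k)).append (mapWires (sysEmb k) C)) := rfl

/-- **The output state of the purified circuit on `|0…0⟩`, entrywise**:
`(1/√2)^k · ⟨x|_{sys}| C |0, copies of x⟩`. [cite: NielsenChuang2010, §2.5] [cite: ShorJordan2008, §1 p. 3] -/
theorem purify_mulVec_zero_apply (C : QCircuit cliffordT (1 + k)) (x : QReg (1 + k + k)) :
    ((purify C).toMatrix 0 *ᵥ basisState (fun _ => false)) x =
      invSqrt2 ^ k * C.toMatrix 0 (x ∘ sysEmb k) (inp (copyOf x)) := by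
  classical
  rw [purify_eq_append, QCircuit.toMatrix_append, QCircuit.toMatrix_append, ← Matrix.mulVec_mulVec,
    ← Matrix.mulVec_mulVec, toMatrix_mapWires, placeGate_mulVec_apply]
  simp_rw [cnotLayer_hLayer_mulVec_zero_apply, balanced_extend_iff]
  simp only [mul_ite, mul_zero, Finset.sum_ite_eq', Finset.mem_univ, if_true]
  ring

/-! ### The acceptance probability of the purified block -/

/-- Splitting a label of the purified block into its system part and its copies. [folklore] -/
def splitEquiv (k : ℕ) : QReg (1 + k + k) ≃ QReg (1 + k) × QReg k where
  toFun x := (x ∘ sysEmb k, copyOf x)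
  invFun p := Fin.append p.1 p.2
  left_inv x := by
    funext w
    refine Fin.addCases (fun j => ?_) (fun i => ?_) w
    · show Fin.append (x ∘ sysEmb k) (copyOf x) (Fin.castAdd k j) = x (Fin.castAdd k j)
      rw [Fin.append_left]; rfl
    · show Fin.append (x ∘ sysEmb k) (copyOf x) (Fin.natAdd (1 + k) i) = x (Fin.natAdd (1 + k) i)
      rw [Fin.append_right]; rfl
  right_inv p := by
    obtain ⟨u, r⟩ := p
    simp only [Prod.mk.injEq]
    refine ⟨funext fun j => ?_, funext fun i => ?_⟩
    · change Fin.append u r (sysEmb k j) = u j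
      rw [show sysEmb k j = Fin.castAdd k j from Fin.ext rfl, Fin.append_left]
    · change Fin.append u r (copyW i) = r i
      rw [copyW, Fin.append_right]

/-- Summing over the labels of the purified block is summing over system parts and copies. [folklore] -/
theorem sum_split {M : Type*} [AddCommMonoid M] (f : QReg (1 + k) → QReg k → M) :
    ∑ x : QReg (1 + k + k), f (x ∘ sysEmb k) (copyOf x) = ∑ r : QReg k, ∑ u : QReg (1 + k), f u r := by
  rw [Fintype.sum_equiv (splitEquiv k) (fun x => f (x ∘ sysEmb k) (copyOf x)) (fun p : QReg (1 + k) × QReg k => f p.1 p.2)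
    (fun x => rfl), Fintype.sum_prod_type, Finset.sum_comm]

/-- The Born probability of "wire `0` reads `1`" on the pure input `|0⟩|r⟩`, as a sum of squared
entries. [cite: NielsenChuang2010, §2.2.5] -/
theorem probEvent_acceptEvent_inp (C : QCircuit cliffordT (1 + k)) (r : QReg k) :
    C.probEvent 0 (basisState (inp r)) (QCircuit.acceptEvent (1 + k)) =
      ∑ u : QReg (1 + k), if u ⟨0, Nat.add_pos_left Nat.one_pos k⟩ = true then ‖C.toMatrix 0 u (inp r)‖ ^ 2 else 0 := by
  classical
  unfold QCircuit.probEvent QCircuit.acceptEvent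
  rw [Finset.sum_filter]
  refine Finset.sum_congr rfl fun u _ => ?_
  have hc : (u ∈ {y : QReg (1 + k) | ∃ h : 0 < 1 + k, y ⟨0, h⟩ = true}) ↔ u ⟨0, Nat.add_pos_left Nat.one_pos k⟩ = true :=
    ⟨fun ⟨_, h⟩ => h, fun h => ⟨_, h⟩⟩
  simp only [hc, QCircuit.runOn, mulVec_basisState]

/-- **Purification.** The probability that wire `0` of the purified block reads `1` (on input
`|0…0⟩`) is the one-clean-qubit acceptance probability of `C`: the uniform average over the
basis inputs `r` of the register of the Born probability on `|0⟩|r⟩`.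
[cite: NielsenChuang2010, §2.5] [cite: ShorJordan2008, §1 p. 3] [cite: KnillLaflamme1998, p. 5673] -/
theorem sum_accept_purify (C : QCircuit cliffordT (1 + k)) :
    (∑ x : QReg (1 + k + k), if x (cleanW k) = true then ‖((purify C).toMatrix 0 *ᵥ basisState (fun _ => false)) x‖ ^ 2 else 0) =
      oneCleanQubitAcceptProb C := by
  classical
  have hterm : ∀ x : QReg (1 + k + k),
      (if x (cleanW k) = true then ‖((purify C).toMatrix 0 *ᵥ basisState (fun _ => false)) x‖ ^ 2 else 0) =
        (1 / 2 : ℝ) ^ k * (if (x ∘ sysEmb k) ⟨0, Nat.add_pos_left Nat.one_pos k⟩ = true then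
          ‖C.toMatrix 0 (x ∘ sysEmb k) (inp (copyOf x))‖ ^ 2 else 0) := by
    intro x
    have e : x (cleanW k) = (x ∘ sysEmb k) ⟨0, Nat.add_pos_left Nat.one_pos k⟩ := rfl
    rw [purify_mulVec_zero_apply, e]
    split_ifs
    · rw [norm_mul, mul_pow, norm_invSqrt2_pow_sq]
    · rw [mul_zero]
  simp_rw [hterm]
  rw [← Finset.mul_sum, sum_split (fun u r => if u ⟨0, Nat.add_pos_left Nat.one_pos k⟩ = true then
    ‖C.toMatrix 0 u (inp r)‖ ^ 2 else 0), Finset.mul_sum]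
  unfold oneCleanQubitAcceptProb
  change _ = ∑ r : QReg k, (1 : ℝ) / 2 ^ k * C.probEvent 0 (basisState (inp r)) (QCircuit.acceptEvent (1 + k))
  refine Finset.sum_congr rfl fun r _ => ?_
  rw [probEvent_acceptEvent_inp, _root_.one_div_pow]

/-- **The output state of the purified block is a unit vector.** [cite: NielsenChuang2010, §2.2.5] -/
theorem sum_normSq_purify (C : QCircuit cliffordT (1 + k)) :
    ∑ x : QReg (1 + k + k), ‖((purify C).toMatrix 0 *ᵥ basisState (fun _ => false)) x‖ ^ 2 = 1 := by
  have h := normSq_mulVec_of_mem_unitaryGroup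
    (QCircuit.toMatrix_mem_unitaryGroup_holds cliffordT_isUnitary_holds 0 (purify C)) (basisState fun _ => false)
  rw [normSq_basisState] at h
  exact h

/-! ### The description of the purified block -/

/-- The description bits of the Hadamard layer: `gateBits 0 1 [1 + k + i]` for `i < k`. [cite: AroraBarak2009, §6.1] -/
def hBits (k : ℕ) : List Bool := (List.range k).flatMap fun i => gateBits 0 1 [1 + k + i]

/-- The Hadamard layer describes as `hBits`. [folklore] -/
theorem flatMap_gateEnc_hLayer (k : ℕ) : (hLayer k).flatMap gateEnc = hBits k := by
  rw [hLayer, copyWires, List.map_map, List.flatMap_map, hBits, ← List.map_coe_finRange_eq_range, List.flatMap_map]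
  refine List.flatMap_congr fun i _ => ?_
  simp only [Function.comp_apply, gateEnc_hOn, val_copyW]

/-- The copying layer describes as `cnotProg`. [folklore] -/
theorem flatMap_gateEnc_cnotLayer (k : ℕ) : (cnotLayer k).flatMap gateEnc = (cnotProg k).flatMap opBits :=
  flatMap_gateEnc_revCompile_toRevList (pw_pos k) _ (cnotProg_lt k) _

/-- **The description of the purified block**: Hadamard bits, `CNOT` bits, then the code of `C`
verbatim (placing `C` on the front wires does not change its description). [cite: AroraBarak2009, §6.1] -/
theorem flatMap_gateEnc_purify (C : QCircuit cliffordT (1 + k)) :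
    (purify C).gates.flatMap gateEnc = hBits k ++ ((cnotProg k).flatMap opBits ++ C.encode) := by
  rw [purify, List.flatMap_append, List.flatMap_append, flatMap_gateEnc_hLayer, flatMap_gateEnc_cnotLayer,
    show C.encode = QCircuit.encode (⟨C.gates⟩ : QCircuit cliffordT (1 + k)) from rfl, encode_eq_flatMap]
  congr 2
  unfold sysEmb
  simp only [gates_mapWires, List.flatMap_map, CWrap.gateEnc_mapWiresGate_castLEEmb]

end DQC1Amp

end Literature.Computability.QuantumComplexity

end
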